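import Summits.NavierStokesRegularity.NavierStokesRegularity.Theorems.LerayQuarterDissipationFiniteDissipationLiouvilleQuietSliceAbsolute
import HarnessLib

/-!
# Crux `FiniteDissipationLiouville` (stmt-NavierStokesRegularity-22144): ABSOLUTE one-slice floors —
# amplitude and `L⁶`

Theorems file of route `LerayQuarterDissipation` (seat ns-lqd-p2 g7; `--supports` the crux).
Navier–Stokes regularity is NOT proved by anything here; no summit is.

Companion of `QuietSliceAbsolute` (p607826: one instant of dissipation `≤ δ₀/√(−t)`, `δ₀` absolute,
forbids the apex singularity). The same forward mechanism — Leray's sup-norm Volterra inequality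
inside the class of Type-I ancient mild fields (KNSS gauge), closed by the tree's comparison
principle `volterra_sqrt_comparison` — gives two more one-slice criteria with ABSOLUTE thresholds:

* `volterra_of_slice` — the common tool: for a Type-I ancient mild field `w` and `0 < T₁ < 1`, the
  clamped sup norm `V(s) = sup_y ‖w(s−1, y)‖` of the translate is measurable, bounded, and obeys
  `V(s) ≤ a(s) + κ ∫₀ˢ (s−τ)^{-1/2} V(τ)² dτ` on `(0, T₁]` for any majorant `a` of the caloric term
  `e^{sΔ}w(−1)` (`κ = oseenSliceConst`; Oseen identity `mild_eq_heatExtension` + pointwise Duhamel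
  bound `norm_oseenDuhamel_le_setIntegral`);
* `bound_of_small_sup_slice` — there is an ABSOLUTE `θ > 0` (`= (16κ)⁻¹`) such that
  `sup_y ‖w(−1,y)‖ ≤ θ` forces `‖w(t,y)‖ ≤ 2θ` for all `−1 < t < 0` (constant supersolution `2θ`;
  maximum principle for the caloric term); NO dissipation law is needed;
* `not_singular_of_small_sup_slice`, `sup_floor_absolute` — scale-invariant forms: ONE instant with
  `√(−t) sup_y ‖w(t,y)‖ ≤ θ` ⇒ bounded on a backward cylinder at the origin; contrapositive: **every
  singular Type-I ancient mild field (any constant `C`) has `sup_y √(−t)‖w(t,y)‖ > θ` at EVERY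
  instant** — compare `AmplitudeThreshold` (p592778: `> θ'` for every `θ' < 1`, but only somewhere in
  every long log-window) and N6d (`typeI_ancient_eq_zero_of_timeConstant_lt_one`: the all-time
  constant `< 1` forces `w ≡ 0`);
* `integral_norm_rpow_six_nsRescale` — `∫ ‖w_c(−1)‖⁶ = c³ ∫ ‖w(−c²)‖⁶`: the `L⁶` size
  `(−t)^{1/4}‖w(t)‖₆` is scale invariant;
* `not_singular_of_small_lsix_slice`, `lsix_floor_absolute` — with the absolute `ε` of
  `QuietSliceAbsolute.bound_of_small_lsix_slice`: a member of `𝒟_{C,K}` with ONE instant of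
  `(−t)^{1/4}‖w(t)‖₆ ≤ ε` is bounded on a backward cylinder; **every singular member of every
  stratum has `(−t)^{1/4}‖w(t)‖₆ > ε` at every instant** — the ancient-solution form of the
  Leray–Giga `L⁶` blow-up rate `‖u(t)‖₆ ≳ (T−t)^{-1/4}`.

References: J. Leray, Acta Math. 63 (1934), §21–§22; W. S. Ożański, B. C. Pooley, LMS Lecture
Note Ser. 452 (2018), Lemma 6.5, Lemma 6.23, Cor. 6.25; Y. Giga, J. Differential Equations 62
(1986), Thm. 4; Koch–Nadirashvili–Seregin–Šverák, Acta Math. 203 (2009), §4.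
-/

noncomputable section

-- the summit and its single sub-problem share the name (CONVENTIONS §1), as in every Theorems file
set_option linter.dupNamespace false

namespace Summit.NavierStokesRegularity.NavierStokesRegularity.Theorems.FiniteDissipationLiouville.AbsoluteFloors

open MeasureTheory Set Filter Topology Metric Function
open Literature.Analysis Literature.Analysis.FluidPDE Literature.Analysis.UnboundedOperators
open Summit.NavierStokesRegularity.NavierStokesRegularity.Theorems.FiniteDissipationLiouville
open scoped ENNReal NNReal

/-! ### The common tool: Leray's Volterra inequality for the sup norm of the translate -/

/-- **Leray's Volterra inequality inside the class.** For a Type-I ancient mild field `w`,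
`0 < T₁ < 1`, and any majorant `a` of the caloric term (`‖e^{sΔ}w(−1)(z)‖ ≤ a(s)` for
`s ∈ (0, T₁]`), there are a measurable `V` and `M > 0` with `0 ≤ V ≤ M`,
`‖w(τ−1, z)‖ ≤ V(τ)` for `τ ∈ [0, T₁]`, and `V(s) ≤ a(s) + κ ∫_{(0,s)} (s−τ)^{-1/2} V(τ)² dτ` on
`(0, T₁]`, `κ = oseenSliceConst` (`V` = the sup norm of the clamped translate; Oseen identity from
the slice `−1`, pointwise Duhamel bound with the slice majorant `V`). [cite: OzanskiPooley2018, (6.65) and Lemma 6.9 (i)] [cite: Leray1934, §21 (3.5)] -/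
theorem volterra_of_slice {C : ℝ} {w : ℝ → EuclideanSpace ℝ (Fin 3) → EuclideanSpace ℝ (Fin 3)}
    (hw : IsTypeIAncientMild C w) {T₁ : ℝ} (hT₁pos : 0 < T₁) (hT₁le : T₁ < 1) {a : ℝ → ℝ}
    (ha : ∀ s ∈ Ioc 0 T₁, ∀ z, ‖heatExtension (w (-1)) s z‖ ≤ a s) :
    ∃ (V : ℝ → ℝ) (M : ℝ), Measurable V ∧ 0 < M ∧ (∀ τ, 0 ≤ V τ) ∧ (∀ τ, V τ ≤ M) ∧
      (∀ τ ∈ Icc 0 T₁, ∀ z, ‖w (τ - 1) z‖ ≤ V τ) ∧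
      ∀ s ∈ Ioc 0 T₁, V s ≤ a s + oseenSliceConst (EuclideanSpace ℝ (Fin 3)) *
        ∫ τ in Ioo 0 s, (s - τ) ^ (-(1 / 2 : ℝ)) * V τ ^ 2 := by
  set κ : ℝ := oseenSliceConst (EuclideanSpace ℝ (Fin 3)) with hκ
  have hC : 0 ≤ C := hw.nonneg
  set u : ℝ → EuclideanSpace ℝ (Fin 3) → EuclideanSpace ℝ (Fin 3) := fun σ => w (σ - 1) with hu
  -- pointwise bound `M` on the window (Type I away from the apex)
  set M : ℝ := max (C / Real.sqrt (1 - T₁)) 1 with hM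
  have hMpos : 0 < M := lt_of_lt_of_le one_pos (le_max_right _ _)
  have hMb : ∀ σ ∈ Icc 0 T₁, ∀ z, ‖u σ z‖ ≤ M := by
    intro σ hσ z
    have hσ1 : σ - 1 < 0 := by linarith [hσ.2]
    refine (hw.norm_le hσ1 z).trans ((div_le_div_of_nonneg_left hC (Real.sqrt_pos.2 (by linarith))
      (Real.sqrt_le_sqrt (by linarith [hσ.2]))).trans (le_max_left _ _))
  -- the clamped sup norm `V`
  obtain ⟨cl, hcl_def⟩ : ∃ cl : ℝ → ℝ, cl = fun τ => max 0 (min τ T₁) := ⟨_, rfl⟩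
  have hcl_mem : ∀ τ, cl τ ∈ Icc 0 T₁ := fun τ => by
    rw [hcl_def]
    exact ⟨le_max_left _ _, max_le hT₁pos.le (min_le_right _ _)⟩
  have hcl_id : ∀ τ ∈ Icc 0 T₁, cl τ = τ := fun τ hτ => by
    rw [hcl_def]
    show max 0 (min τ T₁) = τ
    rw [min_eq_left hτ.2, max_eq_right hτ.1]
  have hcl_cont : Continuous cl := by
    rw [hcl_def]
    exact continuous_const.max (continuous_id.min continuous_const)
  obtain ⟨V, hV⟩ : ∃ V : ℝ → ℝ, V = fun τ => ⨆ z, ‖u (cl τ) z‖ := ⟨_, rfl⟩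
  have hbddV : ∀ τ, BddAbove (range fun z => ‖u (cl τ) z‖) := fun τ =>
    ⟨M, forall_mem_range.2 fun z => hMb _ (hcl_mem τ) z⟩
  have hVle : ∀ τ z, ‖u (cl τ) z‖ ≤ V τ := fun τ z => by
    rw [hV]
    exact le_ciSup (hbddV τ) z
  have hV0 : ∀ τ, 0 ≤ V τ := fun τ => (norm_nonneg _).trans (hVle τ 0)
  have hVM : ∀ τ, V τ ≤ M := fun τ => by
    rw [hV]
    exact ciSup_le fun z => hMb _ (hcl_mem τ) z
  have hVu : ∀ τ ∈ Icc 0 T₁, ∀ z, ‖u τ z‖ ≤ V τ := fun τ hτ z => by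
    have h := hVle τ z
    rwa [hcl_id τ hτ] at h
  have hVm : Measurable V := by
    have hcont : ContinuousOn (uncurry w) (Iio 0 ×ˢ univ) := hw.continuousOn_uncurry
    have hcy : ∀ z : EuclideanSpace ℝ (Fin 3), Continuous fun τ : ℝ => ‖u (cl τ) z‖ := fun z => by
      have h1 : Continuous fun τ : ℝ => (cl τ - 1, z) :=
        (hcl_cont.sub continuous_const).prodMk continuous_const
      have h2 : ∀ τ, (cl τ - 1, z) ∈ Iio (0 : ℝ) ×ˢ (univ : Set (EuclideanSpace ℝ (Fin 3))) :=
        fun τ => ⟨by have := (hcl_mem τ).2; show cl τ - 1 < 0; linarith, mem_univ _⟩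
      exact (hcont.comp_continuous h1 h2).norm
    rw [hV]
    exact (lowerSemicontinuous_ciSup
      (f := fun (z : EuclideanSpace ℝ (Fin 3)) (τ : ℝ) => ‖u (cl τ) z‖) hbddV
      fun z => (hcy z).lowerSemicontinuous).measurable
  refine ⟨V, M, hVm, hMpos, hV0, hVM, fun τ hτ z => hVu τ hτ z, ?_⟩
  -- Leray's integral inequality for `V` on `(0, T₁]`
  intro s hs
  have hs0 : 0 < s := hs.1
  have hsI : s ∈ Icc 0 T₁ := ⟨hs.1.le, hs.2⟩
  have hs1 : s - 1 < 0 := by linarith [hs.2]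
  have hkern : IntegrableOn (fun τ => (s - τ) ^ (-(1 / 2 : ℝ)) * (V τ * V τ)) (Ioo 0 s) := by
    refine Integrable.mul_bdd (c := M * M) (integrableOn_sub_rpow_Ioo (by norm_num))
      ((hVm.mul hVm).aestronglyMeasurable) (Eventually.of_forall fun τ => ?_)
    rw [Real.norm_of_nonneg (mul_nonneg (hV0 τ) (hV0 τ))]
    exact mul_le_mul (hVM τ) (hVM τ) (hV0 τ) hMpos.le
  have hpt : ∀ z, ‖u s z‖ ≤ a s + κ * ∫ τ in Ioo 0 s, (s - τ) ^ (-(1 / 2 : ℝ)) * V τ ^ 2 := by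
    intro z
    have hmild : w (s - 1) z = heatExtension (w (-1)) s z - oseenDuhamel 1 (-1) w w (s - 1) z := by
      have h := hw.mild_eq_heatExtension (s := -1) (t := s - 1) (by linarith) hs1 z
      rwa [show s - 1 - (-1 : ℝ) = s by ring] at h
    have hshift : oseenDuhamel 1 (-1) w w (s - 1) z = oseenDuhamel 1 0 u u s z := by
      have h := oseenDuhamel_comp_sub_right 1 0 s 1 w w z
      rw [show (0 : ℝ) - 1 = -1 by ring] at h
      rw [hu]
      exact h.symm
    have hVu' : ∀ τ ∈ Ioo 0 s, ∀ z', ‖u τ z'‖ ≤ V τ := fun τ hτ z' =>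
      hVu τ ⟨hτ.1.le, hτ.2.le.trans hs.2⟩ z'
    have hduh : ‖oseenDuhamel 1 0 u u s z‖ ≤
        κ * ∫ τ in Ioo 0 s, (s - τ) ^ (-(1 / 2 : ℝ)) * V τ ^ 2 := by
      have h := norm_oseenDuhamel_le_setIntegral hVu' hVu' hkern z
      have e : (fun τ => (s - τ) ^ (-(1 / 2 : ℝ)) * (V τ * V τ)) =
          fun τ => (s - τ) ^ (-(1 / 2 : ℝ)) * V τ ^ 2 := funext fun τ => by rw [sq]
      rw [e] at h
      exact h
    calc ‖u s z‖ = ‖w (s - 1) z‖ := by rw [hu]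
      _ = ‖heatExtension (w (-1)) s z - oseenDuhamel 1 0 u u s z‖ := by rw [hmild, hshift]
      _ ≤ ‖heatExtension (w (-1)) s z‖ + ‖oseenDuhamel 1 0 u u s z‖ := norm_sub_le _ _
      _ ≤ _ := add_le_add (ha s hs z) hduh
  have hVs : V s = ⨆ z, ‖u s z‖ := by
    rw [hV]
    show (⨆ z, ‖u (cl s) z‖) = ⨆ z, ‖u s z‖
    rw [hcl_id s hsI]
  rw [hVs]
  exact ciSup_le hpt

/-! ### One slice of small amplitude: absolute threshold -/

/-- **Small sup norm at one slice ⇒ bounded up to the apex, absolute threshold.** There is an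
absolute `θ > 0` (`= (16κ)⁻¹`) such that every Type-I ancient mild field `w` (ANY constant `C`, no
dissipation law) with `‖w(−1, y)‖ ≤ θ` for all `y` satisfies `‖w(t, y)‖ ≤ 2θ` for all `−1 < t < 0`:
Leray's Volterra inequality with the constant caloric bound `θ` (maximum principle) and the constant
supersolution `2θ` (`θ + 8κθ²√s < 2θ` on `(0,1]`), by `volterra_sqrt_comparison`. [cite: OzanskiPooley2018, Lemma 6.23 (i) and Lemma 6.5] [cite: Leray1934, §21 (3.14)–(3.16)] -/
theorem bound_of_small_sup_slice : ∃ θ > 0, ∀ (C : ℝ)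
    (w : ℝ → EuclideanSpace ℝ (Fin 3) → EuclideanSpace ℝ (Fin 3)),
    IsTypeIAncientMild C w → (∀ y, ‖w (-1) y‖ ≤ θ) →
    ∀ t ∈ Ioo (-1 : ℝ) 0, ∀ y, ‖w t y‖ ≤ 2 * θ := by
  set κ : ℝ := oseenSliceConst (EuclideanSpace ℝ (Fin 3)) with hκ
  have hκpos : 0 < κ := oseenSliceConst_pos
  set θ : ℝ := (16 * κ)⁻¹ with hθ
  have hθpos : 0 < θ := by rw [hθ]; positivity
  have hκθ : 8 * κ * θ = 1 / 2 := by rw [hθ]; field_simp; ring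
  refine ⟨θ, hθpos, fun C w hw hsmall t ht y => ?_⟩
  set T₁ : ℝ := t + 1 with hT₁
  have hT₁pos : 0 < T₁ := by rw [hT₁]; linarith [ht.1]
  have hT₁le : T₁ < 1 := by rw [hT₁]; linarith [ht.2]
  -- the caloric term is bounded by `θ` (maximum principle)
  have ha : ∀ s ∈ Ioc 0 T₁, ∀ z, ‖heatExtension (w (-1)) s z‖ ≤ θ := fun s hs z =>
    norm_heatExtension_le hsmall hs.1 z
  obtain ⟨V, M, hVm, hMpos, hV0, hVM, hVu, hVolt⟩ := volterra_of_slice hw hT₁pos hT₁le ha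
  -- comparison with the constant supersolution `2θ`
  set G : ℝ → ℝ := fun _ => θ + κ * (θ * (8 * θ)) with hG
  have hGθ : ∀ s ∈ Ioc 0 T₁, G s < 2 * θ := by
    intro s _
    show θ + κ * (θ * (8 * θ)) < 2 * θ
    have : κ * (θ * (8 * θ)) = (8 * κ * θ) * θ := by ring
    rw [this, hκθ]
    linarith
  have hψG : ∀ s ∈ Ioc 0 T₁, θ + κ * ∫ τ in Ioo 0 s, (s - τ) ^ (-(1 / 2 : ℝ)) * (2 * θ) ^ 2 ≤ G s := by
    intro s hs
    show θ + κ * ∫ τ in Ioo 0 s, (s - τ) ^ (-(1 / 2 : ℝ)) * (2 * θ) ^ 2 ≤ θ + κ * (θ * (8 * θ))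
    rw [integral_mul_const, Literature.Analysis.FluidPDE.setIntegral_Ioo_sub_rpow_neg_half hs.1.le,
      sub_zero]
    have hs1 : s ^ (1 / 2 : ℝ) ≤ 1 := Real.rpow_le_one hs.1.le (hs.2.trans hT₁le.le) (by norm_num)
    have h1 : 2 * s ^ (1 / 2 : ℝ) * (2 * θ) ^ 2 ≤ θ * (8 * θ) := by nlinarith [hθpos]
    have h2 := mul_le_mul_of_nonneg_left h1 hκpos.le
    linarith
  have hψi : ∀ s ∈ Ioc 0 T₁, IntegrableOn (fun τ => (s - τ) ^ (-(1 / 2 : ℝ)) * (2 * θ) ^ 2) (Ioo 0 s) :=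
    fun s _ => (integrableOn_sub_rpow_Ioo (by norm_num)).mul_const _
  -- initial segment: `V ≤ θ + 2κM²√s ≤ 2θ` for small `s`
  set δ : ℝ := min T₁ ((θ / (2 * κ * M ^ 2 + 1)) ^ 2) with hδ
  have hδpos : 0 < δ := by rw [hδ]; exact lt_min hT₁pos (by positivity)
  have hinit : ∀ s ∈ Ioc 0 δ, V s ≤ 2 * θ := by
    intro s hs
    have hsT : s ∈ Ioc 0 T₁ := ⟨hs.1, hs.2.trans (min_le_left _ _)⟩
    have hk : IntegrableOn (fun τ : ℝ => (s - τ) ^ (-(1 / 2 : ℝ))) (Ioo 0 s) :=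
      integrableOn_sub_rpow_Ioo (by norm_num)
    have hkV : IntegrableOn (fun τ => (s - τ) ^ (-(1 / 2 : ℝ)) * V τ ^ 2) (Ioo 0 s) := by
      refine Integrable.mul_bdd (c := M ^ 2) hk ((hVm.pow_const 2).aestronglyMeasurable) ?_
      refine Eventually.of_forall fun τ => ?_
      rw [Real.norm_of_nonneg (sq_nonneg _)]
      exact pow_le_pow_left₀ (hV0 τ) (hVM τ) 2
    have h1 : ∫ τ in Ioo 0 s, (s - τ) ^ (-(1 / 2 : ℝ)) * V τ ^ 2 ≤ M ^ 2 * (2 * s ^ (1 / 2 : ℝ)) := by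
      calc ∫ τ in Ioo 0 s, (s - τ) ^ (-(1 / 2 : ℝ)) * V τ ^ 2
          ≤ ∫ τ in Ioo 0 s, (s - τ) ^ (-(1 / 2 : ℝ)) * M ^ 2 := by
            refine setIntegral_mono_on hkV (hk.mul_const _) measurableSet_Ioo fun τ hτ => ?_
            exact mul_le_mul_of_nonneg_left (pow_le_pow_left₀ (hV0 τ) (hVM τ) 2)
              (Real.rpow_nonneg (sub_nonneg.2 hτ.2.le) _)
        _ = M ^ 2 * (2 * s ^ (1 / 2 : ℝ)) := by
            rw [integral_mul_const, Literature.Analysis.FluidPDE.setIntegral_Ioo_sub_rpow_neg_half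
              hs.1.le, sub_zero]; ring
    have hs2 : s ^ (1 / 2 : ℝ) ≤ θ / (2 * κ * M ^ 2 + 1) := by
      have hsle : s ≤ (θ / (2 * κ * M ^ 2 + 1)) ^ 2 := hs.2.trans (min_le_right _ _)
      calc s ^ (1 / 2 : ℝ) ≤ ((θ / (2 * κ * M ^ 2 + 1)) ^ 2) ^ (1 / 2 : ℝ) :=
            Real.rpow_le_rpow hs.1.le hsle (by norm_num)
        _ = θ / (2 * κ * M ^ 2 + 1) := by
            rw [← Real.sqrt_eq_rpow, Real.sqrt_sq (by positivity)]
    have h2 : κ * (M ^ 2 * (2 * s ^ (1 / 2 : ℝ))) ≤ θ := by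
      have hden : 0 < 2 * κ * M ^ 2 + 1 := by positivity
      calc κ * (M ^ 2 * (2 * s ^ (1 / 2 : ℝ))) = (2 * κ * M ^ 2) * s ^ (1 / 2 : ℝ) := by ring
        _ ≤ (2 * κ * M ^ 2 + 1) * (θ / (2 * κ * M ^ 2 + 1)) :=
            mul_le_mul (by linarith) hs2 (Real.rpow_nonneg hs.1.le _) hden.le
        _ = θ := mul_div_cancel₀ _ hden.ne'
    calc V s ≤ θ + κ * ∫ τ in Ioo 0 s, (s - τ) ^ (-(1 / 2 : ℝ)) * V τ ^ 2 := hVolt s hsT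
      _ ≤ θ + κ * (M ^ 2 * (2 * s ^ (1 / 2 : ℝ))) := by
          have h3 := mul_le_mul_of_nonneg_left h1 hκpos.le
          linarith
      _ ≤ 2 * θ := by linarith
  have hcomp := volterra_sqrt_comparison (V := V) (ψ := fun _ => 2 * θ) (G := G) (a := fun _ => θ)
    (C := κ) (M := M) (t₁ := T₁) hκpos.le hδpos hVm (fun τ _ => hV0 τ) (fun τ _ => hVM τ)
    hVolt hψG hGθ continuousOn_const continuousOn_const hψi hinit
  have hT₁I : T₁ ∈ Icc 0 T₁ := ⟨hT₁pos.le, le_rfl⟩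
  have h1 : ‖w (T₁ - 1) y‖ ≤ V T₁ := hVu T₁ hT₁I y
  rw [show T₁ - 1 = t by rw [hT₁]; ring] at h1
  exact h1.trans (hcomp T₁ ⟨hT₁pos, le_rfl⟩)

/-- **One slice of small scaled amplitude ⇒ not singular at the apex, absolute threshold**: with
the `θ` of `bound_of_small_sup_slice`, a Type-I ancient mild field (any `C`) having ONE instant
`t < 0` with `√(−t)‖w(t,y)‖ ≤ θ` for all `y` is bounded on some backward cylinder at the origin
(scale the instant to `−1`; the class and the singular clause are scale invariant). [cite: Leray1934, §21–§22] [cite: KochNadirashviliSereginSverak2009, §4 (arXiv:0709.3599 p. 8)] -/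
theorem not_singular_of_small_sup_slice : ∃ θ > 0, ∀ (C : ℝ)
    (w : ℝ → EuclideanSpace ℝ (Fin 3) → EuclideanSpace ℝ (Fin 3)),
    IsTypeIAncientMild C w →
    (∃ t < 0, ∀ y, Real.sqrt (-t) * ‖w t y‖ ≤ θ) →
    ¬ (∀ r > 0, ∀ M : ℝ, ∃ t ∈ Ioo (-(r ^ 2)) (0 : ℝ),
      ∃ x ∈ ball (0 : EuclideanSpace ℝ (Fin 3)) r, M < ‖w t x‖) := by
  obtain ⟨θ, hθ, hbound⟩ := bound_of_small_sup_slice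
  refine ⟨θ, hθ, ?_⟩
  intro C w hw ⟨t₀, ht₀, hq⟩ hsing
  set c : ℝ := Real.sqrt (-t₀) with hc_def
  have hc : 0 < c := Real.sqrt_pos.2 (neg_pos.2 ht₀)
  set v : ℝ → EuclideanSpace ℝ (Fin 3) → EuclideanSpace ℝ (Fin 3) := nsRescale c w with hv_def
  have hv : IsTypeIAncientMild C v := isTypeIAncientMild_nsRescale hw hc
  have hvsing : ∀ r > 0, ∀ M : ℝ, ∃ t ∈ Ioo (-(r ^ 2)) (0 : ℝ),
      ∃ x ∈ ball (0 : EuclideanSpace ℝ (Fin 3)) r, M < ‖v t x‖ :=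
    RecurrentReductionD.singularAtOrigin_nsRescale hsing hc
  have hvsmall : ∀ y, ‖v (-1) y‖ ≤ θ := by
    intro y
    have e : c ^ 2 * (-1 : ℝ) = t₀ := by
      rw [hc_def, Real.sq_sqrt (neg_nonneg.2 ht₀.le)]; ring
    rw [hv_def, nsRescale_apply, e, norm_smul, Real.norm_of_nonneg hc.le]
    exact hq (c • y)
  have hb := hbound C v hv hvsmall
  obtain ⟨t, ht, x, -, hbig⟩ := hvsing 1 one_pos (2 * θ)
  have htI : t ∈ Ioo (-1 : ℝ) 0 := ⟨by linarith [ht.1], ht.2⟩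
  linarith [hb t htI x]

/-- **Absolute instantaneous amplitude floor**: there is an absolute `θ > 0` such that every Type-I
ancient mild field (any constant `C`) which is singular at the apex has, at EVERY instant `t < 0`, a
point `y` with `θ < √(−t)‖w(t,y)‖` (contrapositive of `not_singular_of_small_sup_slice`). [cite: Leray1934, §22] [cite: KochNadirashviliSereginSverak2009, §4 (arXiv:0709.3599 p. 8)] -/
theorem sup_floor_absolute : ∃ θ > 0, ∀ (C : ℝ)
    (w : ℝ → EuclideanSpace ℝ (Fin 3) → EuclideanSpace ℝ (Fin 3)),
    IsTypeIAncientMild C w →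
    (∀ r > 0, ∀ M : ℝ, ∃ t ∈ Ioo (-(r ^ 2)) (0 : ℝ),
      ∃ x ∈ ball (0 : EuclideanSpace ℝ (Fin 3)) r, M < ‖w t x‖) →
    ∀ t < 0, ∃ y, θ < Real.sqrt (-t) * ‖w t y‖ := by
  obtain ⟨θ, hθ, h⟩ := not_singular_of_small_sup_slice
  refine ⟨θ, hθ, fun C w hw hsing t ht => ?_⟩
  by_contra hle
  push Not at hle
  exact h C w hw ⟨t, ht, hle⟩ hsing

/-! ### One slice of small `L⁶` size: scale-invariant form and the `L⁶` floor -/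

/-- **Scaling of the `L⁶` integral of a slice**: `∫ ‖w_c(−1, y)‖⁶ dy = c³ ∫ ‖w(−c², y)‖⁶ dy` for
`w_c(s,x) = c w(c²s, cx)`, `c > 0` (`‖c w‖⁶ = c⁶ ‖w‖⁶` and the substitution `y ↦ cy` costs `c⁻³`). [cite: KochNadirashviliSereginSverak2009, §1 (1.2) (arXiv:0709.3599 p. 2)] -/
theorem integral_norm_rpow_six_nsRescale {c : ℝ} (hc : 0 < c)
    (w : ℝ → EuclideanSpace ℝ (Fin 3) → EuclideanSpace ℝ (Fin 3)) :
    ∫ y, ‖nsRescale c w (-1) y‖ ^ (6 : ℝ) = c ^ 3 * ∫ y, ‖w (c ^ 2 * (-1)) y‖ ^ (6 : ℝ) := by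
  have e1 : (fun y => ‖nsRescale c w (-1) y‖ ^ (6 : ℝ)) =
      fun y => c ^ (6 : ℝ) * (fun z => ‖w (c ^ 2 * (-1)) z‖ ^ (6 : ℝ)) (c • y) := by
    funext y
    rw [nsRescale_apply, norm_smul, Real.norm_of_nonneg hc.le, Real.mul_rpow hc.le (norm_nonneg _)]
  rw [e1, integral_const_mul, Measure.integral_comp_smul_of_nonneg (μ := volume)
    (fun z => ‖w (c ^ 2 * (-1)) z‖ ^ (6 : ℝ)) c (hR := hc.le), finrank_euclideanSpace,
    Fintype.card_fin, smul_eq_mul, ← mul_assoc]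
  congr 1
  rw [show (6 : ℝ) = ((6 : ℕ) : ℝ) by norm_num, Real.rpow_natCast]
  field_simp

/-- **One slice of small scaled `L⁶` size ⇒ not singular, absolute threshold** (members of
`𝒟_{C,K}`; the law is used only to know that slices lie in `L⁶`): with the absolute `ε` of
`QuietSliceAbsolute.bound_of_small_lsix_slice`, ONE instant `t < 0` with
`(−t)^{1/4} (∫‖w(t)‖⁶)^{1/6} ≤ ε` forces boundedness on a backward cylinder at the origin. [cite: OzanskiPooley2018, Cor. 6.24 (iii), Cor. 6.25] [cite: Leray1934, §22] -/
theorem not_singular_of_small_lsix_slice : ∃ ε > 0, ∀ (C K : ℝ)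
    (w : ℝ → EuclideanSpace ℝ (Fin 3) → EuclideanSpace ℝ (Fin 3)),
      IsTypeIAncientMild C w →
      (∀ s : ℝ, s < 0 → ∫⁻ x, ‖fderiv ℝ (w s) x‖ₑ ^ 2 ≤ ENNReal.ofReal (K / Real.sqrt (-s))) →
      (∃ t < 0, (-t) ^ (1 / 4 : ℝ) * (∫ y, ‖w t y‖ ^ (6 : ℝ)) ^ (1 / 6 : ℝ) ≤ ε) →
      ¬ (∀ r > 0, ∀ M : ℝ, ∃ t ∈ Ioo (-(r ^ 2)) (0 : ℝ),
        ∃ x ∈ ball (0 : EuclideanSpace ℝ (Fin 3)) r, M < ‖w t x‖) := by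
  obtain ⟨ε, hε, hbound⟩ := QuietSliceAbsolute.bound_of_small_lsix_slice
  obtain ⟨CL, -, hL6⟩ := Birth.memLp_six_slice
  refine ⟨ε, hε, ?_⟩
  intro C K w hw hlaw ⟨t₀, ht₀, hq⟩ hsing
  set c : ℝ := Real.sqrt (-t₀) with hc_def
  have hc : 0 < c := Real.sqrt_pos.2 (neg_pos.2 ht₀)
  set v : ℝ → EuclideanSpace ℝ (Fin 3) → EuclideanSpace ℝ (Fin 3) := nsRescale c w with hv_def
  have hv : IsTypeIAncientMild C v := isTypeIAncientMild_nsRescale hw hc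
  have hvlaw : ∀ s : ℝ, s < 0 →
      ∫⁻ x, ‖fderiv ℝ (v s) x‖ₑ ^ 2 ≤ ENNReal.ofReal (K / Real.sqrt (-s)) :=
    RecurrentReductionD.dissipationLaw_nsRescale hlaw hc
  have hvsing : ∀ r > 0, ∀ M : ℝ, ∃ t ∈ Ioo (-(r ^ 2)) (0 : ℝ),
      ∃ x ∈ ball (0 : EuclideanSpace ℝ (Fin 3)) r, M < ‖v t x‖ :=
    RecurrentReductionD.singularAtOrigin_nsRescale hsing hc
  have hmem : MemLp (v (-1)) 6 volume := (hL6 C K v hv hvlaw (-1) (by norm_num)).1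
  -- the scaled `L⁶` size is invariant
  have hN : (∫ y, ‖v (-1) y‖ ^ (6 : ℝ)) ^ (1 / 6 : ℝ) ≤ ε := by
    have e : c ^ 2 * (-1 : ℝ) = t₀ := by
      rw [hc_def, Real.sq_sqrt (neg_nonneg.2 ht₀.le)]; ring
    have hI0 : 0 ≤ ∫ y, ‖w t₀ y‖ ^ (6 : ℝ) := integral_nonneg fun y => by positivity
    rw [hv_def, integral_norm_rpow_six_nsRescale hc, e, Real.mul_rpow (by positivity) hI0]
    have hc3 : (c ^ 3) ^ (1 / 6 : ℝ) = (-t₀) ^ (1 / 4 : ℝ) := by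
      rw [hc_def, Real.sqrt_eq_rpow, ← Real.rpow_natCast, ← Real.rpow_mul (neg_nonneg.2 ht₀.le),
        ← Real.rpow_mul (neg_nonneg.2 ht₀.le)]
      norm_num
    rw [hc3]
    exact hq
  have hb := hbound C v hv hmem hN
  obtain ⟨t, ht, x, -, hbig⟩ := hvsing (1 / 2) (by norm_num) (4 * ε)
  have htI : t ∈ Ioo (-1 : ℝ) 0 := ⟨by linarith [ht.1], ht.2⟩
  have hbt := hb t htI x
  have hpow : (t + 1) ^ (-(1 / 4 : ℝ)) ≤ 2 := by
    have ht1 : (1 / 2 : ℝ) ≤ t + 1 := by nlinarith [ht.1]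
    calc (t + 1) ^ (-(1 / 4 : ℝ)) ≤ (1 / 2 : ℝ) ^ (-(1 / 4 : ℝ)) :=
          Real.rpow_le_rpow_of_nonpos (by norm_num) ht1 (by norm_num)
      _ ≤ (1 / 2 : ℝ) ^ (-(1 : ℝ)) :=
          Real.rpow_le_rpow_of_exponent_ge (by norm_num) (by norm_num) (by norm_num)
      _ = 2 := by norm_num
  have : ‖v t x‖ ≤ 4 * ε := by
    calc ‖v t x‖ ≤ 2 * ε * (t + 1) ^ (-(1 / 4 : ℝ)) := hbt
      _ ≤ 2 * ε * 2 := mul_le_mul_of_nonneg_left hpow (by positivity)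
      _ = 4 * ε := by ring
  linarith

/-- **Absolute instantaneous `L⁶` floor** — the ancient-solution form of the Leray–Giga `L⁶` blow-up
rate: there is an absolute `ε > 0` such that every member of every stratum `𝒟_{C,K}` which is
singular at the apex has `ε < (−t)^{1/4} (∫‖w(t)‖⁶)^{1/6}` at EVERY instant `t < 0`. [cite: OzanskiPooley2018, Cor. 6.25] [cite: Leray1934, §22] -/
theorem lsix_floor_absolute : ∃ ε > 0, ∀ (C K : ℝ)
    (w : ℝ → EuclideanSpace ℝ (Fin 3) → EuclideanSpace ℝ (Fin 3)),
      IsTypeIAncientMild C w →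
      (∀ s : ℝ, s < 0 → ∫⁻ x, ‖fderiv ℝ (w s) x‖ₑ ^ 2 ≤ ENNReal.ofReal (K / Real.sqrt (-s))) →
      (∀ r > 0, ∀ M : ℝ, ∃ t ∈ Ioo (-(r ^ 2)) (0 : ℝ),
        ∃ x ∈ ball (0 : EuclideanSpace ℝ (Fin 3)) r, M < ‖w t x‖) →
      ∀ t < 0, ε < (-t) ^ (1 / 4 : ℝ) * (∫ y, ‖w t y‖ ^ (6 : ℝ)) ^ (1 / 6 : ℝ) := by
  obtain ⟨ε, hε, h⟩ := not_singular_of_small_lsix_slice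
  refine ⟨ε, hε, fun C K w hw hlaw hsing t ht => ?_⟩
  by_contra hle
  push Not at hle
  exact h C K w hw hlaw ⟨t, ht, hle⟩ hsing

end Summit.NavierStokesRegularity.NavierStokesRegularity.Theorems.FiniteDissipationLiouville.AbsoluteFloors

end
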